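import Summits.BirchSwinnertonDyer.BirchSwinnertonDyer.Theorems.AlignedTransportAtTwoMainConjectureOfRankZeroBSDAtTwoSelmerLayerDescentMonotone
import Summits.BirchSwinnertonDyer.BirchSwinnertonDyer.Theorems.PublishedInputsGreenbergLemma34CyclicExtension
import Literature.NumberTheory.EllipticCurves.Greenberg1999.ControlLocalKernelsLayerGoodProofs
import Literature.NumberTheory.EllipticCurves.Greenberg1999.ControlLocalKernelsLayerMultiplicativeProofs
import Literature.NumberTheory.EllipticCurves.Greenberg1999.ControlLocalKernelsLayerAdditiveProofs
import Literature.NumberTheory.EllipticCurves.BSDRankZeroDensity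
import HarnessLib

/-!
# Route `AlignedTransportAtTwo`, crux C2 `MainConjectureOfRankZeroBSDAtTwo` (stmt-BirchSwinnertonDyer-22298):
# THE GROWTH-BUDGET DOOR — `μ₂ = 0` (the TOWER gap, hence Mazur's main conjecture at `2` modulo PRINT) for a cell curve
# whose `2`-Selmer rank grows by LESS THAN `2^{j′} − 3 − log₂ ∏` from `ℚ` to the layer `ℚ_{j′}`; in particular
# ★ `2`-SELMER STATIONARITY AT `ℚ(ζ₁₆)⁺` CERTIFIES `μ₂ = 0` — with NO tower PRINT binder left

HONEST FRAMING (cell `bsd-f1-sign2`, WIDTH-5 attached prover seat `bsd-line-att-p5` gen 45 on line `birth` of the lead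
`bsd-line-att-p2`; `--supports` stmt-BirchSwinnertonDyer-22298, closes nothing; BSD is NOT proved by any of this; the crux C2,
its verdict «blocked-on `Rank1Residual.GreenbergMuConjectureIrreducible`» and every registered stub are untouched). THEOREMS ONLY —
no `def`, no instance, no named fact, no `sorry`. PLACEMENT: COROLLARY-OF-TREE — g44's `towerGapAtTwo_of_descent_cert` (the TOWER
road's `KatoHalfPinch.towerGapAtTwo_of_layerSelmer_cert` in descent currency) with (i) its four PRINT binders `h33g`/`hM`/`hA`/`hS34`
DISCHARGED by the tree's theorems (`Greenberg1999.lemma33_localTowerKerPrimary_eq_bot_of_good_holds`,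
`…cyclic_of_multiplicative_holds`, `…le_four_of_additive_holds`, `InputsGreenbergLemma34Layer.lemma34_localTowerKerPrimary_cyclicExtension_rat_holds`
— Greenberg LNM 1716 Lemmas 3.3/3.4, proved in the tree by cells `bsd-2adic` / `bsd-inputs`), and (ii) the lower layer read at `j = 0`
with `2^a = #Sel^(2)(E/ℚ)` EXACTLY (a `2`-group), so that the certificate becomes a statement about the GROWTH of the `2`-Selmer rank.

* §1 `towerGapAtTwo_of_descent_cert_free`, `towerGapAtTwo_of_descent_cert_of_shaAn_even_free` — g44's two certificates with NO
  tower PRINT binder (same kit hypotheses `hlow`/`hup`/`harith`).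
* §2 ★★★ `towerGapAtTwo_of_descent_growthBudget` — **THE GROWTH-BUDGET DOOR**: for `W/ℚ` (globally minimal, elliptic) good ordinary
  at `2` without a rational `2`-torsion abscissa, odd bad primes `P ⊇ {ℓ odd : ℓ ∣ Δ_min}` with the road's local constants `C_ℓ, e_ℓ`
  (branch condition `hC` verbatim), a layer `j′` and a budget `g` with **`#Sel^(2)(E/ℚ_{j′}) ≤ 2^g · #Sel^(2)(E/ℚ)`** for every cyclotomic
  presentation and **`2^g · 4 · ∏ C_ℓ^{2^{min(j′,e_ℓ)}} < 2^{2^{j′} − 1}`**: `X5.O1.TowerGapAtTwo W` (⟹ `X(W/ℚ_∞)` torsion with `μ₂ = 0` for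
  every presentation, `isTorsion_and_mu_eq_zero_of_descent_growthBudget`).
* §3 ★★★ `towerGapAtTwo_of_selmer_stationary_layerTwo` — **STATIONARITY AT `ℚ(ζ₁₆)⁺`**: if every odd prime of `Δ_min` is a prime of
  multiplicative reduction with ODD `ord_ℓ Δ_min`, and **`#Sel^(2)(E/ℚ(ζ₁₆)⁺) ≤ #Sel^(2)(E/ℚ)`** (no growth of the `2`-Selmer group from `ℚ`
  to the second layer; `≥` is automatic, `…DescentMonotone`), then `TowerGapAtTwo W`; `towerGapAtTwo_of_selmer_growth_le_four_layerThree` —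
  same odd-prime shape, **growth by at most `4` ranks up to `ℚ(ζ₃₂)⁺`** suffices.
* §4 `mazurMainConjecture_two_of_selmer_stationary_layerTwo`, `…_of_descent_growthBudget` — composed with att-p3 g13's closer:
  **`MazurMainConjecture W 2` from PRINT₄ {Kato 17.4 (1)(2) at `2`, period unit, modularity, GZK} + `r_an = 0` + `BSD₂(W)` + ONE `2`-descent
  over `ℚ(ζ₁₆)⁺` returning the rank over `ℚ`** (resp. one over `ℚ_{j′}` within budget). CONDITIONAL on the displayed PRINT₄ only.

Reading. The floor of `…DescentMonotone` says `d_{j′} ≥ d_0`; this file says how much room there is above the floor: at `ℚ(ζ₁₆)⁺` none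
(`g = 0`, clean odd primes), at `ℚ(ζ₃₂)⁺` four ranks, at `ℚ(ζ₆₄)⁺` twelve (`2^g·4 < 2^{15}`). If `μ₂(W) ≥ 1` the `2`-Selmer ranks of the layers grow at least
like `2^{j′}` up to a bounded error (g43's completeness theorem `seedMuZero_iff_exists_descent_rankJump_two` makes this precise), so a
budget linear in `2^{j′}` is the natural shape of road (a). Nothing here runs a descent; `μ₂ = 0` is certified
for no curve by this file.

References: R. Greenberg, LNM 1716 (1999), §1 Conj. 1.11, §3 Lemmas 3.1–3.5, §4 [GreenbergLNM1716]; K. Kato, Astérisque 295 (2004),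
Thm. 17.4 [Kato2004Asterisque]; J. H. Silverman, GTM 106, Thm. X.4.2 [SilvermanAEC2009]; L. C. Washington, GTM 83, §13.1 [Washington1997];
R. L. Miller, LMS J. Comput. Math. 14 (2011), Def. 1.1 [Miller2011LMS].
-/

set_option linter.dupNamespace false
set_option autoImplicit false

noncomputable section

open scoped Classical AddSubgroup MatrixGroups ModularForm

namespace Summit.BirchSwinnertonDyer.BirchSwinnertonDyer.Theorems.AlignedTransportAtTwoSelmerLayerDescentGrowthBudget

open CongruenceSubgroup WeierstrassCurve Literature.NumberTheory.EllipticCurves Literature.NumberTheory.EllipticCurves.Greenberg1999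
  Literature.NumberTheory.EllipticCurves.ModularForms
  Literature.NumberTheory.EllipticCurves.Rank1Residual Literature.NumberTheory.EllipticCurves.Rank1Residual.Typed
  Summit.BirchSwinnertonDyer.Rank1Residual.X5.O1
  Summit.BirchSwinnertonDyer.BirchSwinnertonDyer.Theorems.Rank1ResidualX1Defs
  Summit.BirchSwinnertonDyer.BirchSwinnertonDyer.Theorems.AlignedTransportAtTwoSeedKernelEC
  Summit.BirchSwinnertonDyer.BirchSwinnertonDyer.Theorems.InputsGreenbergLemma34Layer
  Summit.BirchSwinnertonDyer.BirchSwinnertonDyer.Theorems.AlignedTransportAtTwoSelmerLayerMuDoorDescent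
  Summit.BirchSwinnertonDyer.BirchSwinnertonDyer.Theorems.AlignedTransportAtTwoSelmerLayerMuDoorDescentBase
  Summit.BirchSwinnertonDyer.BirchSwinnertonDyer.Theorems.AlignedTransportAtTwoSelmerLayerMuDoorDescentTowerCert
  Summit.BirchSwinnertonDyer.BirchSwinnertonDyer.Theorems.AlignedTransportAtTwoSelmerLayerDescentMonotone

variable (W : WeierstrassCurve ℚ) [W.IsElliptic] [W.IsGloballyMinimal]

/-! ## §1 g44's certificates with the four tower PRINT binders discharged -/

/-- **The TOWER gap certificate in descent currency with NO tower PRINT binder**: `…DescentTowerCert.towerGapAtTwo_of_descent_cert` with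
`h33g`, `hM`, `hA` (Greenberg's Lemma 3.3 for good / multiplicative / additive `v ∤ 2`) and `hS34` (Lemma 3.4 at `v ∣ 2` for `ℚ`) fed by
the tree's theorems. Remaining inputs: the cell hypotheses, the explicit local data `P, C, e, k` with its branch condition, and the two
kit counts `2^a ≤ #Sel^(2)(E/ℚ_j)`, `#Sel^(2)(E/ℚ_{j′}) ≤ 2^d` with `2^d · 4 · ∏ C_ℓ^{2^{min(j′,e_ℓ)}} < 2^{2^{j′} − 2^j + a}`.
[cite: GreenbergLNM1716, §3 Lemmas 3.3–3.5, §4] [cite: SilvermanAEC2009, Thm. X.4.2] -/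
theorem towerGapAtTwo_of_descent_cert_free
    (hord : IsOrdinaryAt W 2) (ht : ∀ x : ℚ, ¬ HasRationalTwoTorsionX W x) {j j' a d : ℕ} (hjj' : j ≤ j')
    (P : Finset ℕ) (hP : ∀ ℓ ∈ P, ℓ.Prime ∧ ℓ ≠ 2)
    (hΔ : ∀ ℓ : ℕ, ℓ.Prime → ℓ ≠ 2 → (ℓ : ℤ) ∣ W.minimalDiscriminantInt → ℓ ∈ P)
    (C e k : ℕ → ℕ) (he : ∀ ℓ ∈ P, ¬ 2 ^ (e ℓ + 4) ∣ ℓ ^ 2 - 1)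
    (hC : ∀ (ℓ : ℕ) [Fact ℓ.Prime], ℓ ∈ P →
      4 ≤ C ℓ ∨ (W.HasMultiplicativeReductionAtPrime ℓ ∧ 2 ≤ C ℓ) ∨
        (W.HasMultiplicativeReductionAtPrime ℓ ∧ (ℓ : ℤ) ^ k ℓ ∣ W.minimalDiscriminantInt ∧
          ¬ (ℓ : ℤ) ^ (k ℓ + 1) ∣ W.minimalDiscriminantInt ∧ ¬ 2 ∣ k ℓ ∧ 1 ≤ C ℓ) ∨
        (¬ (ℓ : ℤ) ∣ W.minimalDiscriminantInt ∧ 1 ≤ C ℓ))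
    (hlow : ∀ κ : ZpExtension ℚ 2, κ.IsCyclotomic → 2 ^ a ≤ Nat.card ((W.baseChange (κ.layer j)).selmerGroup 2))
    (hup : ∀ κ : ZpExtension ℚ 2, κ.IsCyclotomic → Nat.card ((W.baseChange (κ.layer j')).selmerGroup 2) ≤ 2 ^ d)
    (harith : 2 ^ d * 4 * ∏ ℓ ∈ P, C ℓ ^ 2 ^ min j' (e ℓ) < 2 ^ (2 ^ j' - 2 ^ j + a)) :
    TowerGapAtTwo W :=
  towerGapAtTwo_of_descent_cert W lemma33_localTowerKerPrimary_eq_bot_of_good_holds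
    lemma33_localTowerKerPrimary_cyclic_of_multiplicative_holds lemma33_natCard_localTowerKerPrimary_le_four_of_additive_holds
    lemma34_localTowerKerPrimary_cyclicExtension_rat_holds hord ht hjj' P hP hΔ C e k he hC hlow hup harith

/-- **The Ш-nontrivial certificate with NO tower PRINT binder**: `…DescentTowerCert.towerGapAtTwo_of_descent_cert_of_shaAn_even` with
`h33g`/`hM`/`hA`/`hS34` fed by the tree. Inputs: `BSD₂(W)`, `r_an = 0`, `#Ш_an = q` with `ord₂ q ≠ 0`, the local data, ONE kit count
`#Sel^(2)(E/ℚ_{j′}) ≤ 2^d` with `2^d · 4 · ∏ < 2^{2^{j′} + 1}`. [cite: GreenbergLNM1716, §3 Lemmas 3.3–3.5, §4] [cite: Miller2011LMS, Def. 1.1] -/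
theorem towerGapAtTwo_of_descent_cert_of_shaAn_even_free
    (hord : IsOrdinaryAt W 2) (ht : ∀ x : ℚ, ¬ HasRationalTwoTorsionX W x)
    (hbsd : BSDp W 2) (hr : W.analyticRank = 0) {q : ℚ} (hq : shaAn W = (q : ℂ)) (hv : padicValRat 2 q ≠ 0)
    {j' d : ℕ} (P : Finset ℕ) (hP : ∀ ℓ ∈ P, ℓ.Prime ∧ ℓ ≠ 2)
    (hΔ : ∀ ℓ : ℕ, ℓ.Prime → ℓ ≠ 2 → (ℓ : ℤ) ∣ W.minimalDiscriminantInt → ℓ ∈ P)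
    (C e k : ℕ → ℕ) (he : ∀ ℓ ∈ P, ¬ 2 ^ (e ℓ + 4) ∣ ℓ ^ 2 - 1)
    (hC : ∀ (ℓ : ℕ) [Fact ℓ.Prime], ℓ ∈ P →
      4 ≤ C ℓ ∨ (W.HasMultiplicativeReductionAtPrime ℓ ∧ 2 ≤ C ℓ) ∨
        (W.HasMultiplicativeReductionAtPrime ℓ ∧ (ℓ : ℤ) ^ k ℓ ∣ W.minimalDiscriminantInt ∧
          ¬ (ℓ : ℤ) ^ (k ℓ + 1) ∣ W.minimalDiscriminantInt ∧ ¬ 2 ∣ k ℓ ∧ 1 ≤ C ℓ) ∨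
        (¬ (ℓ : ℤ) ∣ W.minimalDiscriminantInt ∧ 1 ≤ C ℓ))
    (hup : ∀ κ : ZpExtension ℚ 2, κ.IsCyclotomic → Nat.card ((W.baseChange (κ.layer j')).selmerGroup 2) ≤ 2 ^ d)
    (harith : 2 ^ d * 4 * ∏ ℓ ∈ P, C ℓ ^ 2 ^ min j' (e ℓ) < 2 ^ (2 ^ j' + 1)) :
    TowerGapAtTwo W :=
  towerGapAtTwo_of_descent_cert_of_shaAn_even W lemma33_localTowerKerPrimary_eq_bot_of_good_holds
    lemma33_localTowerKerPrimary_cyclic_of_multiplicative_holds lemma33_natCard_localTowerKerPrimary_le_four_of_additive_holds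
    lemma34_localTowerKerPrimary_cyclicExtension_rat_holds hord ht hbsd hr hq hv P hP hΔ C e k he hC hup harith

/-! ## §2 The growth-budget door -/

omit [W.IsGloballyMinimal] in
/-- `#Sel^(2)(E/ℚ) = 2^a` for some `a` (the `2`-Selmer group of a `2`-descent over `ℚ` is a finite group killed by `2`; tree
`exists_natCard_selmerGroup_eq_pow`). [cite: SilvermanAEC2009, Thm. X.4.2(b)] -/
theorem exists_natCard_selmerGroup_two_eq_pow : ∃ a : ℕ, Nat.card (W.selmerGroup 2) = 2 ^ a := by
  simpa only [Nat.cast_ofNat] using exists_natCard_selmerGroup_eq_pow W 2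

omit [W.IsGloballyMinimal] in
/-- Layer `0` in descent currency is the `2`-descent over `ℚ`: `#Sel^(2)(E/ℚ_0) = #Sel^(2)(E/ℚ)` (g44 `natCard_selmerGroup_two_layer_eq` at
`n = 0` and `natCard_selmerGroup_two_eq_natCard_torsionBy_selmerLayer_zero`). [cite: SilvermanAEC2009, Thm. X.4.2] [cite: Washington1997, §13.1] -/
theorem natCard_selmerGroup_two_layer_zero_eq (ht : ∀ x : ℚ, ¬ HasRationalTwoTorsionX W x) (κ : ZpExtension ℚ 2) :
    Nat.card ((W.baseChange (κ.layer 0)).selmerGroup 2) = Nat.card (W.selmerGroup 2) := by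
  rw [natCard_selmerGroup_two_layer_eq W ht κ 0, natCard_selmerGroup_two_eq_natCard_torsionBy_selmerLayer_zero W ht κ]

/-- ★★★ **THE GROWTH-BUDGET DOOR.** For `W/ℚ` (globally minimal, elliptic) good ordinary at `2` WITHOUT a rational `2`-torsion abscissa,
a finite set `P` of odd primes containing every odd prime of `Δ_min` with the road's local constants `C_ℓ, e_ℓ, k_ℓ` (branch condition
`hC` verbatim), a layer `j′` and a budget `g`: if for every cyclotomic presentation **`#Sel^(2)(E/ℚ_{j′}) ≤ 2^g · #Sel^(2)(E/ℚ)`** (the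
`2`-Selmer rank grows by at most `g` from `ℚ` to `ℚ_{j′}`) and **`2^g · 4 · ∏_{ℓ∈P} C_ℓ^{2^{min(j′,e_ℓ)}} < 2^{2^{j′} − 1}`**, then
`X5.O1.TowerGapAtTwo W`. Proof: §1 at `(j, j′) = (0, j′)` with `2^a = #Sel^(2)(E/ℚ)` exactly and `d = a + g`. No tower PRINT binder; no
descent is run here. [cite: GreenbergLNM1716, §1 Conj. 1.11; §3 Lemmas 3.1–3.5; §4] [cite: SilvermanAEC2009, Thm. X.4.2] [cite: Washington1997, §13.1] -/
theorem towerGapAtTwo_of_descent_growthBudget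
    (hord : IsOrdinaryAt W 2) (ht : ∀ x : ℚ, ¬ HasRationalTwoTorsionX W x) {j' g : ℕ}
    (P : Finset ℕ) (hP : ∀ ℓ ∈ P, ℓ.Prime ∧ ℓ ≠ 2)
    (hΔ : ∀ ℓ : ℕ, ℓ.Prime → ℓ ≠ 2 → (ℓ : ℤ) ∣ W.minimalDiscriminantInt → ℓ ∈ P)
    (C e k : ℕ → ℕ) (he : ∀ ℓ ∈ P, ¬ 2 ^ (e ℓ + 4) ∣ ℓ ^ 2 - 1)
    (hC : ∀ (ℓ : ℕ) [Fact ℓ.Prime], ℓ ∈ P →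
      4 ≤ C ℓ ∨ (W.HasMultiplicativeReductionAtPrime ℓ ∧ 2 ≤ C ℓ) ∨
        (W.HasMultiplicativeReductionAtPrime ℓ ∧ (ℓ : ℤ) ^ k ℓ ∣ W.minimalDiscriminantInt ∧
          ¬ (ℓ : ℤ) ^ (k ℓ + 1) ∣ W.minimalDiscriminantInt ∧ ¬ 2 ∣ k ℓ ∧ 1 ≤ C ℓ) ∨
        (¬ (ℓ : ℤ) ∣ W.minimalDiscriminantInt ∧ 1 ≤ C ℓ))
    (hgrow : ∀ κ : ZpExtension ℚ 2, κ.IsCyclotomic →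
      Nat.card ((W.baseChange (κ.layer j')).selmerGroup 2) ≤ 2 ^ g * Nat.card (W.selmerGroup 2))
    (harith : 2 ^ g * 4 * ∏ ℓ ∈ P, C ℓ ^ 2 ^ min j' (e ℓ) < 2 ^ (2 ^ j' - 1)) :
    TowerGapAtTwo W := by
  obtain ⟨a, ha⟩ := exists_natCard_selmerGroup_two_eq_pow W
  have h1j : 1 ≤ 2 ^ j' := Nat.one_le_two_pow
  refine towerGapAtTwo_of_descent_cert_free W hord ht (Nat.zero_le j') P hP hΔ C e k he hC (a := a) (d := a + g)
    (fun κ _ ↦ by rw [natCard_selmerGroup_two_layer_zero_eq W ht κ, ha]) (fun κ hκ ↦ ?_) ?_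
  · calc Nat.card ((W.baseChange (κ.layer j')).selmerGroup 2) ≤ 2 ^ g * Nat.card (W.selmerGroup 2) := hgrow κ hκ
      _ = 2 ^ (a + g) := by rw [ha, pow_add, mul_comm]
  · have hexp : 2 ^ j' - 2 ^ 0 + a = a + (2 ^ j' - 1) := by rw [pow_zero]; omega
    rw [hexp, pow_add, pow_add]
    have hpos : 0 < 2 ^ a := Nat.two_pow_pos a
    calc 2 ^ a * 2 ^ g * 4 * ∏ ℓ ∈ P, C ℓ ^ 2 ^ min j' (e ℓ) = 2 ^ a * (2 ^ g * 4 * ∏ ℓ ∈ P, C ℓ ^ 2 ^ min j' (e ℓ)) := by ring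
      _ < 2 ^ a * 2 ^ (2 ^ j' - 1) := Nat.mul_lt_mul_of_pos_left harith hpos

/-- ★★ **`μ₂ = 0` from the growth budget**: under the hypotheses of `towerGapAtTwo_of_descent_growthBudget`, for every cyclotomic
presentation `(κ, γ)` with `γ` a cyclotomic variable and every dual datum `D`, `X(W/ℚ_∞)` is `Λ`-torsion with `μ₂(X) = 0` (cell
`bsd-2adic`'s `isTorsion_and_mu_eq_zero_of_towerGapAtTwo`). This IS stub T's conclusion for that presentation; it holds only for the
curves that satisfy the (kit) growth hypothesis. [cite: GreenbergLNM1716, §1 Conj. 1.11; §3 Lemmas 3.1–3.5] -/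
theorem isTorsion_and_mu_eq_zero_of_descent_growthBudget
    (hord : IsOrdinaryAt W 2) (ht : ∀ x : ℚ, ¬ HasRationalTwoTorsionX W x) {j' g : ℕ}
    (P : Finset ℕ) (hP : ∀ ℓ ∈ P, ℓ.Prime ∧ ℓ ≠ 2)
    (hΔ : ∀ ℓ : ℕ, ℓ.Prime → ℓ ≠ 2 → (ℓ : ℤ) ∣ W.minimalDiscriminantInt → ℓ ∈ P)
    (C e k : ℕ → ℕ) (he : ∀ ℓ ∈ P, ¬ 2 ^ (e ℓ + 4) ∣ ℓ ^ 2 - 1)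
    (hC : ∀ (ℓ : ℕ) [Fact ℓ.Prime], ℓ ∈ P →
      4 ≤ C ℓ ∨ (W.HasMultiplicativeReductionAtPrime ℓ ∧ 2 ≤ C ℓ) ∨
        (W.HasMultiplicativeReductionAtPrime ℓ ∧ (ℓ : ℤ) ^ k ℓ ∣ W.minimalDiscriminantInt ∧
          ¬ (ℓ : ℤ) ^ (k ℓ + 1) ∣ W.minimalDiscriminantInt ∧ ¬ 2 ∣ k ℓ ∧ 1 ≤ C ℓ) ∨
        (¬ (ℓ : ℤ) ∣ W.minimalDiscriminantInt ∧ 1 ≤ C ℓ))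
    (hgrow : ∀ κ : ZpExtension ℚ 2, κ.IsCyclotomic →
      Nat.card ((W.baseChange (κ.layer j')).selmerGroup 2) ≤ 2 ^ g * Nat.card (W.selmerGroup 2))
    (harith : 2 ^ g * 4 * ∏ ℓ ∈ P, C ℓ ^ 2 ^ min j' (e ℓ) < 2 ^ (2 ^ j' - 1))
    {κ : ZpExtension ℚ 2} (hκ : κ.IsCyclotomic) {γ : Field.absoluteGaloisGroup ℚ} (hγ : κ.IsTopGenerator γ)
    (hγ' : IsCyclotomicVariable 2 γ) (D : W.SelmerDualData κ γ) :
    D.IsTorsion ∧ D.mu = 0 :=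
  isTorsion_and_mu_eq_zero_of_towerGapAtTwo W
    (towerGapAtTwo_of_descent_growthBudget W hord ht P hP hΔ C e k he hC hgrow harith) hκ hγ hγ' D

/-! ## §3 Stationarity at `ℚ(ζ₁₆)⁺`; growth `≤ 4` at `ℚ(ζ₃₂)⁺` (odd bad primes multiplicative with odd discriminant exponent) -/

omit [W.IsElliptic] [W.IsGloballyMinimal] in
/-- Bookkeeping for the `C_ℓ = 1` road: with `e_ℓ := ℓ²` the side condition `2^{e_ℓ+4} ∤ ℓ² − 1` holds for every prime `ℓ`
(`0 < ℓ² − 1 < 2^{ℓ²} ≤ 2^{ℓ²+4}`). [folklore] -/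
theorem not_two_pow_sq_add_four_dvd {ℓ : ℕ} (hℓ : ℓ.Prime) : ¬ 2 ^ (ℓ ^ 2 + 4) ∣ ℓ ^ 2 - 1 := by
  intro h
  have h2 : 2 ≤ ℓ := hℓ.two_le
  have hsq : 4 ≤ ℓ ^ 2 := by nlinarith
  have hpos : 0 < ℓ ^ 2 - 1 := by omega
  have hle : 2 ^ (ℓ ^ 2 + 4) ≤ ℓ ^ 2 - 1 := Nat.le_of_dvd hpos h
  have hlt : ℓ ^ 2 < 2 ^ (ℓ ^ 2) := Nat.lt_two_pow_self
  have hmono : 2 ^ (ℓ ^ 2) ≤ 2 ^ (ℓ ^ 2 + 4) := Nat.pow_le_pow_right two_pos (by omega)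
  omega

/-- ★★★ **`2`-SELMER STATIONARITY AT `ℚ(ζ₁₆)⁺` CERTIFIES `μ₂ = 0`.** For `W/ℚ` (globally minimal, elliptic) good ordinary at `2` WITHOUT
a rational `2`-torsion abscissa, whose odd primes of bad reduction (a finite set `P ⊇ {ℓ odd : ℓ ∣ Δ_min}`) are all primes of
MULTIPLICATIVE reduction with ODD `ord_ℓ Δ_min` (`= k_ℓ`): if for every cyclotomic presentation **`#Sel^(2)(E/ℚ(ζ₁₆)⁺) ≤ #Sel^(2)(E/ℚ)`**
(the `2`-descent over the degree-`4` layer `ℚ_2 = ℚ(ζ₁₆)⁺` returns the SAME rank as over `ℚ`; `≥` holds always,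
`…DescentMonotone.natCard_selmerGroup_two_le_layer`) then `X5.O1.TowerGapAtTwo W`. (The growth-budget door at `j′ = 2`, `g = 0`,
`C_ℓ = 1`: `4 < 2^3`.) [cite: GreenbergLNM1716, §1 Conj. 1.11; §3 Lemmas 3.1–3.5; §4] [cite: SilvermanAEC2009, Thm. X.4.2]
[cite: Washington1997, §13.1] -/
theorem towerGapAtTwo_of_selmer_stationary_layerTwo
    (hord : IsOrdinaryAt W 2) (ht : ∀ x : ℚ, ¬ HasRationalTwoTorsionX W x)
    (P : Finset ℕ) (hP : ∀ ℓ ∈ P, ℓ.Prime ∧ ℓ ≠ 2)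
    (hΔ : ∀ ℓ : ℕ, ℓ.Prime → ℓ ≠ 2 → (ℓ : ℤ) ∣ W.minimalDiscriminantInt → ℓ ∈ P) (k : ℕ → ℕ)
    (hmult : ∀ (ℓ : ℕ) [Fact ℓ.Prime], ℓ ∈ P →
      W.HasMultiplicativeReductionAtPrime ℓ ∧ (ℓ : ℤ) ^ k ℓ ∣ W.minimalDiscriminantInt ∧
        ¬ (ℓ : ℤ) ^ (k ℓ + 1) ∣ W.minimalDiscriminantInt ∧ ¬ 2 ∣ k ℓ)
    (hstat : ∀ κ : ZpExtension ℚ 2, κ.IsCyclotomic →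
      Nat.card ((W.baseChange (κ.layer 2)).selmerGroup 2) ≤ Nat.card (W.selmerGroup 2)) :
    TowerGapAtTwo W := by
  refine towerGapAtTwo_of_descent_growthBudget W hord ht (j' := 2) (g := 0) P hP hΔ (fun _ ↦ 1) (fun ℓ ↦ ℓ ^ 2) k
    (fun ℓ hℓ ↦ not_two_pow_sq_add_four_dvd (hP ℓ hℓ).1) (fun ℓ _ hℓ ↦ ?_) (fun κ hκ ↦ by simpa using hstat κ hκ) ?_
  · obtain ⟨h1, h2, h3, h4⟩ := hmult ℓ hℓ
    exact Or.inr (Or.inr (Or.inl ⟨h1, h2, h3, h4, le_rfl⟩))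
  · simp

/-- ★★ **GROWTH BY AT MOST FOUR RANKS UP TO `ℚ(ζ₃₂)⁺` CERTIFIES `μ₂ = 0`** (same odd-prime shape): if for every cyclotomic presentation
`#Sel^(2)(E/ℚ(ζ₃₂)⁺) ≤ 16 · #Sel^(2)(E/ℚ)` then `TowerGapAtTwo W` (the growth-budget door at `j′ = 3`, `g = 4`, `C_ℓ = 1`: `16 · 4 < 2^7`).
[cite: GreenbergLNM1716, §1 Conj. 1.11; §3 Lemmas 3.1–3.5; §4] [cite: SilvermanAEC2009, Thm. X.4.2] [cite: Washington1997, §13.1] -/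
theorem towerGapAtTwo_of_selmer_growth_le_four_layerThree
    (hord : IsOrdinaryAt W 2) (ht : ∀ x : ℚ, ¬ HasRationalTwoTorsionX W x)
    (P : Finset ℕ) (hP : ∀ ℓ ∈ P, ℓ.Prime ∧ ℓ ≠ 2)
    (hΔ : ∀ ℓ : ℕ, ℓ.Prime → ℓ ≠ 2 → (ℓ : ℤ) ∣ W.minimalDiscriminantInt → ℓ ∈ P) (k : ℕ → ℕ)
    (hmult : ∀ (ℓ : ℕ) [Fact ℓ.Prime], ℓ ∈ P →
      W.HasMultiplicativeReductionAtPrime ℓ ∧ (ℓ : ℤ) ^ k ℓ ∣ W.minimalDiscriminantInt ∧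
        ¬ (ℓ : ℤ) ^ (k ℓ + 1) ∣ W.minimalDiscriminantInt ∧ ¬ 2 ∣ k ℓ)
    (hgrow : ∀ κ : ZpExtension ℚ 2, κ.IsCyclotomic →
      Nat.card ((W.baseChange (κ.layer 3)).selmerGroup 2) ≤ 16 * Nat.card (W.selmerGroup 2)) :
    TowerGapAtTwo W := by
  refine towerGapAtTwo_of_descent_growthBudget W hord ht (j' := 3) (g := 4) P hP hΔ (fun _ ↦ 1) (fun ℓ ↦ ℓ ^ 2) k
    (fun ℓ hℓ ↦ not_two_pow_sq_add_four_dvd (hP ℓ hℓ).1) (fun ℓ _ hℓ ↦ ?_) (fun κ hκ ↦ by simpa using hgrow κ hκ) ?_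
  · obtain ⟨h1, h2, h3, h4⟩ := hmult ℓ hℓ
    exact Or.inr (Or.inr (Or.inl ⟨h1, h2, h3, h4, le_rfl⟩))
  · simp

/-! ## §4 Mazur's main conjecture at `2` per curve from PRINT₄ + `BSD₂` + one `2`-descent within budget -/

/-- ★★★ **`MazurMainConjecture W 2` FROM `2`-SELMER STATIONARITY AT `ℚ(ζ₁₆)⁺`.** For `W/ℚ` globally minimal, good ordinary at `2`, no
rational `2`-torsion abscissa, `r_an(W) = 0`, `BSD₂(W)`, odd bad primes all multiplicative with odd `ord_ℓ Δ_min`, granted PRINT₄ {Kato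
17.4 (1)(2) at `2` (`h17`), the period unit (`hper`), modularity (`hmod`), GZK (`hGZK`)}: ONE `2`-descent over `ℚ(ζ₁₆)⁺` returning the rank
over `ℚ` gives Mazur's `2`-adic main conjecture for `W` (att-p3 g13's closer `mazurMainConjecture_two_of_bsdp_of_towerGap` ∘ §3).
CONDITIONAL on the displayed PRINT₄; closes nothing by itself; BSD is not proved by this. [cite: Kato2004Asterisque, Thm. 17.4 (1)(2) (p. 273)]
[cite: GreenbergLNM1716, §3–§4] [cite: Miller2011LMS, Def. 1.1] -/
theorem mazurMainConjecture_two_of_selmer_stationary_layerTwo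
    (h17 : ∀ [NeZero (W.conductorNorm ℤ)] (f : CuspForm (Gamma0 (W.conductorNorm ℤ)) 2),
      kato_divisibility_allPrimes W 2 (f := f))
    (hper : realPeriodRat_eq_unit_mul_plusPeriod_two) (hmod : nonempty_modularParametrizationData)
    (hGZK : rank_eq_analyticRank_of_analyticRank_le_one)
    (hord : IsOrdinaryAt W 2) (ht : ∀ x : ℚ, ¬ HasRationalTwoTorsionX W x) (hr : W.analyticRank = 0) (hbsd : BSDp W 2)
    (P : Finset ℕ) (hP : ∀ ℓ ∈ P, ℓ.Prime ∧ ℓ ≠ 2)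
    (hΔ : ∀ ℓ : ℕ, ℓ.Prime → ℓ ≠ 2 → (ℓ : ℤ) ∣ W.minimalDiscriminantInt → ℓ ∈ P) (k : ℕ → ℕ)
    (hmult : ∀ (ℓ : ℕ) [Fact ℓ.Prime], ℓ ∈ P →
      W.HasMultiplicativeReductionAtPrime ℓ ∧ (ℓ : ℤ) ^ k ℓ ∣ W.minimalDiscriminantInt ∧
        ¬ (ℓ : ℤ) ^ (k ℓ + 1) ∣ W.minimalDiscriminantInt ∧ ¬ 2 ∣ k ℓ)
    (hstat : ∀ κ : ZpExtension ℚ 2, κ.IsCyclotomic →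
      Nat.card ((W.baseChange (κ.layer 2)).selmerGroup 2) ≤ Nat.card (W.selmerGroup 2)) :
    MazurMainConjecture W 2 :=
  mazurMainConjecture_two_of_bsdp_of_towerGap W h17 hper hmod hGZK hord ht hr hbsd
    (towerGapAtTwo_of_selmer_stationary_layerTwo W hord ht P hP hΔ k hmult hstat)

/-- ★★ **`MazurMainConjecture W 2` from PRINT₄ + `BSD₂` + ONE `2`-descent over `ℚ_{j′}` WITHIN BUDGET** (general local data):
`mazurMainConjecture_two_of_bsdp_of_towerGap` ∘ `towerGapAtTwo_of_descent_growthBudget`. CONDITIONAL on the displayed PRINT₄; closes nothing.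
[cite: Kato2004Asterisque, Thm. 17.4 (1)(2) (p. 273)] [cite: GreenbergLNM1716, §3–§4] [cite: Miller2011LMS, Def. 1.1] -/
theorem mazurMainConjecture_two_of_descent_growthBudget
    (h17 : ∀ [NeZero (W.conductorNorm ℤ)] (f : CuspForm (Gamma0 (W.conductorNorm ℤ)) 2),
      kato_divisibility_allPrimes W 2 (f := f))
    (hper : realPeriodRat_eq_unit_mul_plusPeriod_two) (hmod : nonempty_modularParametrizationData)
    (hGZK : rank_eq_analyticRank_of_analyticRank_le_one)
    (hord : IsOrdinaryAt W 2) (ht : ∀ x : ℚ, ¬ HasRationalTwoTorsionX W x) (hr : W.analyticRank = 0) (hbsd : BSDp W 2)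
    {j' g : ℕ} (P : Finset ℕ) (hP : ∀ ℓ ∈ P, ℓ.Prime ∧ ℓ ≠ 2)
    (hΔ : ∀ ℓ : ℕ, ℓ.Prime → ℓ ≠ 2 → (ℓ : ℤ) ∣ W.minimalDiscriminantInt → ℓ ∈ P)
    (C e k : ℕ → ℕ) (he : ∀ ℓ ∈ P, ¬ 2 ^ (e ℓ + 4) ∣ ℓ ^ 2 - 1)
    (hC : ∀ (ℓ : ℕ) [Fact ℓ.Prime], ℓ ∈ P →
      4 ≤ C ℓ ∨ (W.HasMultiplicativeReductionAtPrime ℓ ∧ 2 ≤ C ℓ) ∨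
        (W.HasMultiplicativeReductionAtPrime ℓ ∧ (ℓ : ℤ) ^ k ℓ ∣ W.minimalDiscriminantInt ∧
          ¬ (ℓ : ℤ) ^ (k ℓ + 1) ∣ W.minimalDiscriminantInt ∧ ¬ 2 ∣ k ℓ ∧ 1 ≤ C ℓ) ∨
        (¬ (ℓ : ℤ) ∣ W.minimalDiscriminantInt ∧ 1 ≤ C ℓ))
    (hgrow : ∀ κ : ZpExtension ℚ 2, κ.IsCyclotomic →
      Nat.card ((W.baseChange (κ.layer j')).selmerGroup 2) ≤ 2 ^ g * Nat.card (W.selmerGroup 2))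
    (harith : 2 ^ g * 4 * ∏ ℓ ∈ P, C ℓ ^ 2 ^ min j' (e ℓ) < 2 ^ (2 ^ j' - 1)) :
    MazurMainConjecture W 2 :=
  mazurMainConjecture_two_of_bsdp_of_towerGap W h17 hper hmod hGZK hord ht hr hbsd
    (towerGapAtTwo_of_descent_growthBudget W hord ht P hP hΔ C e k he hC hgrow harith)

end Summit.BirchSwinnertonDyer.BirchSwinnertonDyer.Theorems.AlignedTransportAtTwoSelmerLayerDescentGrowthBudget

end
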